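import Mathlib

/-!
# SoloBlind — the fixed-branch tail of a bad chain: the two certificates of Theorem B(i) (paper §15.3)

Context (solo-blind programme on `ResolutionOfSingularities`, W-side, surface model BU₂).  Let `σ` be an
automorphism of `B = k[[x,y]]` with both axes stable, `σ(x) = x(1+ξ)`, `σ(y) = y(1+η)`, `ξ, η ∈ 𝔪`.
Following the branch `{y = 0}` for `n` steps gives the local ring `B_n = k[[x, y_n]]`, `y = x^n y_n`, with
`δx = x·ξ` and `δy_n = y_n · ((1+ξ)^{-n}(1+η) − 1)`.  Theorem B(i) says the point `P_n` carries a Totaro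
certificate as soon as `ξ` and `η` are comparable in `B_n` (which monomialisation guarantees for `n ≫ 0`).
The two comparability cases are the two purely algebraic statements proved here (sorry-free), in any
commutative (local) ring in which `1 + ξ` is a unit:

* `dvd_twist_sub_one_of_dvd` — if `ξ ∣ η` then `ξ ∣ u⁻ⁿ(1+η) − 1` for `u = 1+ξ`; with
  `SoloBlind.span_pair_le_span_of_dvd` (file `SoloBlindBranchLinearisation`) this is the certificate
  `(e, s) = (ξ, x)`: the fixed ideal `(x ξ, y_n(u⁻ⁿ(1+η) − 1))` lies in `(ξ)` and `δx = ξ · x`;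
* `twist_sub_one_eq_mul_unit_of_dvd` — if `η ∣ ξ` with `ξ = η·q`, `q ∈ 𝔪` (local ring), then
  `u⁻ⁿ(1+η) − 1 = η · w` with `w` a unit: the certificate `(e, s) = (η, y_n)` (`δy_n = η · y_n · w` and
  `η ∣ x ξ = δx`), packaged as `fixedIdeal_le_span_eta`.
-/

namespace Summit.ResolutionOfSingularities.ResolutionOfSingularities.Theorems.SoloBlind

open Finset

section AnyRing

variable {R : Type*} [CommRing R]

/-- `ξ ∣ (1+ξ)^n − 1`. -/
theorem self_dvd_one_add_pow_sub_one (ξ : R) (n : ℕ) : ξ ∣ (1 + ξ) ^ n - 1 := by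
  have h := geom_sum_mul (1 + ξ) n
  rw [add_sub_cancel_left] at h
  exact ⟨∑ i ∈ range n, (1 + ξ) ^ i, by rw [← h, mul_comm]⟩

/-- The twisted character of the `n`-th infinitely near point along the branch:
`u⁻ⁿ(1+η) − 1 = u⁻ⁿ · (η − ((1+ξ)^n − 1))` for a unit `u` with `↑u = 1 + ξ`. -/
theorem twist_sub_one_eq (ξ η : R) (u : Rˣ) (hu : (u : R) = 1 + ξ) (n : ℕ) :
    (↑(u⁻¹ ^ n) : R) * (1 + η) - 1 = (↑(u⁻¹ ^ n) : R) * (η - ((1 + ξ) ^ n - 1)) := by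
  have hinv : (↑(u⁻¹ ^ n) : R) * (1 + ξ) ^ n = 1 := by
    rw [← hu, ← Units.val_pow_eq_pow_val, ← Units.val_mul, inv_pow, inv_mul_cancel,
      Units.val_one]
  have : (↑(u⁻¹ ^ n) : R) * (η - ((1 + ξ) ^ n - 1))
      = (↑(u⁻¹ ^ n) : R) * (1 + η) - (↑(u⁻¹ ^ n) : R) * (1 + ξ) ^ n := by ring
  rw [this, hinv]

/-- Certificate `(ξ, x)`: if `ξ ∣ η` then `ξ` divides the twisted character `u⁻ⁿ(1+η) − 1`. -/
theorem dvd_twist_sub_one_of_dvd (ξ η : R) (u : Rˣ) (hu : (u : R) = 1 + ξ) (n : ℕ)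
    (h : ξ ∣ η) : ξ ∣ (↑(u⁻¹ ^ n) : R) * (1 + η) - 1 := by
  rw [twist_sub_one_eq ξ η u hu n]
  exact Dvd.dvd.mul_left (dvd_sub h (self_dvd_one_add_pow_sub_one ξ n)) _

/-- With `δx = x ξ` and `δy_n = y_n (u⁻ⁿ(1+η) − 1)`: if `ξ ∣ η` the fixed ideal lies in `(ξ)`. -/
theorem fixedIdeal_le_span_xi (x yn ξ η : R) (u : Rˣ) (hu : (u : R) = 1 + ξ) (n : ℕ)
    (h : ξ ∣ η) :
    Ideal.span {x * ξ, yn * ((↑(u⁻¹ ^ n) : R) * (1 + η) - 1)} ≤ Ideal.span {ξ} := by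
  rw [Ideal.span_le]
  intro z hz
  simp only [Set.mem_insert_iff, Set.mem_singleton_iff] at hz
  rcases hz with rfl | rfl
  · exact Ideal.mem_span_singleton.mpr (Dvd.intro_left x rfl)
  · exact Ideal.mem_span_singleton.mpr
      (Dvd.dvd.mul_left (dvd_twist_sub_one_of_dvd ξ η u hu n h) yn)

end AnyRing

section Local

variable {R : Type*} [CommRing R] [IsLocalRing R]

/-- Certificate `(η, y_n)`: if `ξ = η q` with `q ∈ 𝔪` then `u⁻ⁿ(1+η) − 1 = η · w` with `w` a unit. -/
theorem twist_sub_one_eq_mul_unit_of_dvd (ξ η q : R) (hq : q ∈ IsLocalRing.maximalIdeal R)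
    (hξ : ξ = η * q) (u : Rˣ) (hu : (u : R) = 1 + ξ) (n : ℕ) :
    ∃ w : R, IsUnit w ∧ (↑(u⁻¹ ^ n) : R) * (1 + η) - 1 = η * w := by
  obtain ⟨S, hS⟩ := self_dvd_one_add_pow_sub_one ξ n
  -- (1+ξ)^n − 1 = ξ S = η (q S)
  refine ⟨(↑(u⁻¹ ^ n) : R) * (1 - q * S), ?_, ?_⟩
  · refine (Units.isUnit _).mul ?_
    have hmem : q * S ∈ IsLocalRing.maximalIdeal R := Ideal.mul_mem_right _ _ hq
    have h1 : (1 : R) - q * S ∉ IsLocalRing.maximalIdeal R := by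
      intro hcontra
      have : (1 : R) ∈ IsLocalRing.maximalIdeal R := by
        simpa using Ideal.add_mem _ hcontra hmem
      exact (IsLocalRing.maximalIdeal.isMaximal R).ne_top
        ((Ideal.eq_top_iff_one _).mpr this)
    exact (IsLocalRing.notMem_maximalIdeal).mp h1
  · rw [twist_sub_one_eq ξ η u hu n, hS, hξ]
    ring

/-- With `δx = x ξ`, `δy_n = y_n (u⁻ⁿ(1+η) − 1)`, `ξ = η q`, `q ∈ 𝔪`: the fixed ideal lies in `(η)`
(and `δy_n ∈ η · y_n · Rˣ` by `twist_sub_one_eq_mul_unit_of_dvd`): the certificate `(e, s) = (η, y_n)`. -/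
theorem fixedIdeal_le_span_eta (x yn ξ η q : R) (hq : q ∈ IsLocalRing.maximalIdeal R)
    (hξ : ξ = η * q) (u : Rˣ) (hu : (u : R) = 1 + ξ) (n : ℕ) :
    Ideal.span {x * ξ, yn * ((↑(u⁻¹ ^ n) : R) * (1 + η) - 1)} ≤ Ideal.span {η} := by
  obtain ⟨w, -, hw⟩ := twist_sub_one_eq_mul_unit_of_dvd ξ η q hq hξ u hu n
  rw [Ideal.span_le]
  intro z hz
  simp only [Set.mem_insert_iff, Set.mem_singleton_iff] at hz
  rcases hz with rfl | rfl
  · exact Ideal.mem_span_singleton.mpr ⟨x * q, by rw [hξ]; ring⟩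
  · exact Ideal.mem_span_singleton.mpr ⟨yn * w, by rw [hw]; ring⟩

/-- The dichotomy packaged: if `ξ` and `η` are comparable — `ξ ∣ η`, or `ξ = η q` with `q ∈ 𝔪` — then the
fixed ideal of the `n`-th point along the branch is contained in a principal ideal `(e)` with `e ∈ {ξ, η}`
and the corresponding coordinate is an exact logarithmic generator (`δx = ξ·x`, resp. `δy_n = η·y_n·unit`). -/
theorem fixedBranchTail_certificate (x yn ξ η : R) (u : Rˣ) (hu : (u : R) = 1 + ξ) (n : ℕ)
    (hcomp : ξ ∣ η ∨ ∃ q ∈ IsLocalRing.maximalIdeal R, ξ = η * q) :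
    (Ideal.span {x * ξ, yn * ((↑(u⁻¹ ^ n) : R) * (1 + η) - 1)} ≤ Ideal.span {ξ}) ∨
    (Ideal.span {x * ξ, yn * ((↑(u⁻¹ ^ n) : R) * (1 + η) - 1)} ≤ Ideal.span {η} ∧
      ∃ w : R, IsUnit w ∧ yn * ((↑(u⁻¹ ^ n) : R) * (1 + η) - 1) = η * yn * w) := by
  rcases hcomp with h | ⟨q, hq, hξ⟩
  · exact Or.inl (fixedIdeal_le_span_xi x yn ξ η u hu n h)
  · refine Or.inr ⟨fixedIdeal_le_span_eta x yn ξ η q hq hξ u hu n, ?_⟩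
    obtain ⟨w, hwU, hw⟩ := twist_sub_one_eq_mul_unit_of_dvd ξ η q hq hξ u hu n
    exact ⟨w, hwU, by rw [hw]; ring⟩

end Local

end Summit.ResolutionOfSingularities.ResolutionOfSingularities.Theorems.SoloBlind
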